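import Literature.NumberTheory.FaltingsSerre.ParamodularBridge
import HarnessLib

/-!
# An integer criterion for "type (G)": all roots of a surface-shaped `L`-polynomial have absolute value `p^{-1/2}`

[BPPTVY, Prop 4.3.2 p. 1168] sorts a paramodular eigenform `f` at a good prime `p` into types (G), (Y),
(P), … by the absolute values of the reciprocal roots of `Q_p(f,T)`; type (G) at one good prime is the
hypothesis under which [Thm 4.3.4 p. 1169] attaches `ρ_{f,ℓ}` (the hypothesis `hG` of the cited fact
`BrumerEtAl2019.existsIntegralSymplecticGaloisRep_two_primeLevel` and of the template
`paramodular_of_galoisCertificate_cited`).  For a surface-shaped polynomial with INTEGER coefficients,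
`Q(T) = 1 − aT + bT² − paT³ + p²T⁴` (`lPolynomialOfSurface p a b`), "every complex root `z` of `Q` has
`|z| = p^{−1/2}`" is equivalent to four integer inequalities,
`a² − 4b + 8p ≥ 0`, `a² ≤ 16p`, `2p + b ≥ 0`, `4a²p ≤ (2p + b)²`
(put `y = pz + 1/z`: then `y² − ay + (b − 2p) = 0`, and `|z| = p^{−1/2}` for both roots `z` of
`pz² − yz + 1` iff `y` is real with `y² ≤ 4p`).  This file proves the direction needed to DISCHARGE `hG`
from the integers `(a_p(f), b_p(f))` of a certificate: the four inequalities imply the root condition.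
This is the implication (iii) ⇒ (i) of a PRINTED lemma, [MN02, Lemma 2.1 p. 323] (after Rück 1990), for the
reciprocal polynomial; it is proved here from first principles (the converse is `TypeGCriterionConverse.lean`).

References: [BPPTVY] = Brumer–Pacetti–Poor–Tornaría–Voight–Yuen, Prop 4.3.2 p. 1168, Thm 4.3.4
p. 1169 ("Suppose that f is of type (G)"). [cite: BrumerEtAl2019]
[MN02] = D. Maisner, E. Nart, *Abelian surfaces over finite fields as Jacobians* (with an appendix by E. W. Howe), Experiment. Math. **11**:3 (2002) 321–337 [cite: MaisnerNart2002]: **Lemma 2.1 p. 323** ("We review results of Rück and Xing …"): for a monic `f(t) = t⁴ + a₁t³ + a₂t² + qa₁t + q² ∈ ℤ[t]`, (i) all roots of `f` are `q`-Weil numbers (`|π| = √q`) ⇔ (iii) `|a₁| ≤ 4√q` and `2|a₁|√q − 2q ≤ a₂ ≤ a₁²/4 + 2q`.  Dictionary: `q = p`, `f(t) = t⁴·Q(1/t)`, `a₁ = −a`, `a₂ = b`, roots `π = 1/z`; `|a₁| ≤ 4√q ⇔ a² ≤ 16p`, `a₂ ≤ a₁²/4 + 2q ⇔ a² − 4b +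 8p ≥ 0`, `2|a₁|√q − 2q ≤ a₂ ⇔ (2p + b ≥ 0 ∧ 4a²p ≤ (2p + b)²)`.
-/

open Polynomial Complex

namespace Literature.NumberTheory.FaltingsSerre

/-- Core computation.  If `p > 0`, `y₀ ∈ ℝ` with `y₀² ≤ 4p`, and `z ∈ ℂ` satisfies
`p z² − y₀ z + 1 = 0`, then `‖z‖² = 1/p` (indeed `2pz = y₀ ± i√(4p − y₀²)`) — the step (ii) ⇒ (i) of
[MN02, Lemma 2.1]. [cite: MaisnerNart2002, Lemma 2.1 p. 323] -/
theorem norm_sq_eq_inv_of_quadratic {p y₀ : ℝ} (hp : 0 < p) (hy : y₀ ^ 2 ≤ 4 * p) {z : ℂ}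
    (hz : (p : ℂ) * z ^ 2 - y₀ * z + 1 = 0) : ‖z‖ ^ 2 = p⁻¹ := by
  set t : ℝ := Real.sqrt (4 * p - y₀ ^ 2) with ht_def
  have ht2 : t ^ 2 = 4 * p - y₀ ^ 2 := Real.sq_sqrt (by linarith)
  have hsq : (2 * (p : ℂ) * z - y₀) ^ 2 = ((t : ℂ) * I) ^ 2 := by
    have ht2' : (t : ℂ) ^ 2 = 4 * (p : ℂ) - (y₀ : ℂ) ^ 2 := by exact_mod_cast ht2
    rw [mul_pow, I_sq, ht2']
    linear_combination (4 * (p : ℂ)) * hz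
  have hnorm : ‖2 * (p : ℂ) * z‖ ^ 2 = 4 * p := by
    rcases sq_eq_sq_iff_eq_or_eq_neg.1 hsq with h | h
    · have h' : 2 * (p : ℂ) * z = (y₀ : ℂ) + (t : ℂ) * I := by rw [← h]; ring
      rw [h', ← Complex.normSq_eq_norm_sq, Complex.normSq_add_mul_I]; linarith
    · have h' : 2 * (p : ℂ) * z = (y₀ : ℂ) + ((-t : ℝ) : ℂ) * I := by
        rw [Complex.ofReal_neg, neg_mul, ← h]; ring
      rw [h', ← Complex.normSq_eq_norm_sq, Complex.normSq_add_mul_I]; nlinarith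
  have h2p : ‖2 * (p : ℂ) * z‖ = 2 * p * ‖z‖ := by
    rw [norm_mul, show (2 * (p : ℂ)) = ((2 * p : ℝ) : ℂ) by push_cast; ring,
      Complex.norm_of_nonneg (by linarith)]
  rw [h2p] at hnorm
  have hp0 : p ≠ 0 := hp.ne'
  field_simp
  nlinarith [hnorm]

/-- **Integer criterion for type (G)** (the direction used to discharge `hG`).  Let `p > 0` and
`a b ∈ ℤ` with `a² − 4b + 8p ≥ 0`, `a² ≤ 16p`, `2p + b ≥ 0` and `4a²p ≤ (2p + b)²`.  Then every complex
root `z` of `Q(T) = 1 − aT + bT² − paT³ + p²T⁴` satisfies `‖z‖² = 1/p`.  Proof: `z ≠ 0`;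
`y := pz + 1/z` satisfies `y² − ay + (b − 2p) = 0`, whose roots `(a ± √(a² − 4b + 8p))/2` are real of
square `≤ 4p` under the four inequalities; and `pz² − yz + 1 = 0` — (iii) ⇒ (ii) ⇒ (i) of [MN02, Lemma 2.1].
[cite: MaisnerNart2002, Lemma 2.1 p. 323] -/
theorem norm_sq_eq_inv_of_surface_root {p : ℕ} (hp : 0 < p) {a b : ℤ}
    (h₁ : 0 ≤ a ^ 2 - 4 * b + 8 * p) (h₂ : a ^ 2 ≤ 16 * p) (h₃ : 0 ≤ 2 * p + b)
    (h₄ : 4 * a ^ 2 * p ≤ (2 * p + b) ^ 2) {z : ℂ}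
    (hz : 1 - (a : ℂ) * z + (b : ℂ) * z ^ 2 - (p : ℂ) * (a : ℂ) * z ^ 3 + (p : ℂ) ^ 2 * z ^ 4 = 0) :
    ‖z‖ ^ 2 = (p : ℝ)⁻¹ := by
  -- real versions of the hypotheses
  have hpR : (0 : ℝ) < p := by exact_mod_cast hp
  have h₁R : (0 : ℝ) ≤ (a : ℝ) ^ 2 - 4 * b + 8 * p := by exact_mod_cast h₁
  have h₂R : (a : ℝ) ^ 2 ≤ 16 * p := by exact_mod_cast h₂
  have h₃R : (0 : ℝ) ≤ 2 * p + b := by exact_mod_cast h₃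
  have h₄R : 4 * (a : ℝ) ^ 2 * p ≤ (2 * p + b) ^ 2 := by exact_mod_cast h₄
  have hz0 : z ≠ 0 := by
    rintro rfl
    norm_num at hz
  -- the trace variable `y = p z + 1/z`
  set y : ℂ := (p : ℂ) * z + z⁻¹ with hy_def
  have hy : y ^ 2 - (a : ℂ) * y + ((b : ℂ) - 2 * p) = 0 := by
    have key : z ^ 2 * (y ^ 2 - (a : ℂ) * y + ((b : ℂ) - 2 * p)) =
        1 - (a : ℂ) * z + (b : ℂ) * z ^ 2 - (p : ℂ) * (a : ℂ) * z ^ 3 + (p : ℂ) ^ 2 * z ^ 4 := by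
      rw [hy_def]
      field_simp
      ring
    exact (mul_eq_zero.1 (key.trans hz)).resolve_left (pow_ne_zero 2 hz0)
  have hq : (p : ℂ) * z ^ 2 - y * z + 1 = 0 := by
    rw [hy_def]
    field_simp
    ring
  -- `y` is one of the two real roots `(a ± r)/2`, `r = √(a² − 4b + 8p)`
  set r : ℝ := Real.sqrt ((a : ℝ) ^ 2 - 4 * b + 8 * p) with hr_def
  have hr0 : 0 ≤ r := Real.sqrt_nonneg _
  have hr2 : r ^ 2 = (a : ℝ) ^ 2 - 4 * b + 8 * p := Real.sq_sqrt h₁R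
  have hfac : (y - (((a : ℝ) + r) / 2 : ℝ)) * (y - (((a : ℝ) - r) / 2 : ℝ)) =
      y ^ 2 - (a : ℂ) * y + ((b : ℂ) - 2 * p) := by
    have hr2' : (r : ℂ) ^ 2 = (a : ℂ) ^ 2 - 4 * (b : ℂ) + 8 * (p : ℂ) := by exact_mod_cast hr2
    push_cast
    linear_combination (-(1 : ℂ) / 4) * hr2'
  have hroots : y = ((((a : ℝ) + r) / 2 : ℝ) : ℂ) ∨ y = ((((a : ℝ) - r) / 2 : ℝ) : ℂ) := by
    rcases mul_eq_zero.1 (hfac.trans hy) with h | h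
    · exact Or.inl (sub_eq_zero.1 h)
    · exact Or.inr (sub_eq_zero.1 h)
  -- both real roots have square ≤ 4p
  set s : ℝ := Real.sqrt p with hs_def
  have hs0 : 0 < s := Real.sqrt_pos.2 hpR
  have hs2 : s ^ 2 = p := Real.sq_sqrt hpR.le
  have hm4s : |(a : ℝ)| ≤ 4 * s :=
    abs_le_of_sq_le_sq (by nlinarith [hs2, h₂R]) (by positivity)
  have h2ms : 2 * |(a : ℝ)| * s ≤ 2 * p + b := by
    have h : |2 * (a : ℝ) * s| ≤ 2 * p + b :=
      abs_le_of_sq_le_sq (by nlinarith [hs2, h₄R]) h₃R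
    rwa [abs_mul, abs_mul, abs_of_pos hs0, abs_of_pos (by norm_num : (0 : ℝ) < 2)] at h
  have hr4s : r ≤ 4 * s - |(a : ℝ)| := by
    have habs : |(a : ℝ)| ^ 2 = (a : ℝ) ^ 2 := sq_abs _
    have h : r ^ 2 ≤ (4 * s - |(a : ℝ)|) ^ 2 := by rw [hr2]; nlinarith [hs2, habs, h2ms]
    have := abs_le_of_sq_le_sq h (by linarith [hm4s])
    rwa [abs_of_nonneg hr0] at this
  have hbound : ∀ y₀ : ℝ, |y₀| ≤ |(a : ℝ)| / 2 + r / 2 → y₀ ^ 2 ≤ 4 * p := by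
    intro y₀ hy₀
    have h16 : (4 * s) ^ 2 = 16 * p := by nlinarith [hs2]
    have hle : |y₀| ≤ 2 * s := by linarith [hr4s]
    obtain ⟨hl, hu⟩ := abs_le.1 hle
    nlinarith [sq_le_sq' hl hu, hs2]
  have hplus : (((a : ℝ) + r) / 2) ^ 2 ≤ 4 * p := by
    apply hbound
    calc |((a : ℝ) + r) / 2| = |(a : ℝ) + r| / 2 := by rw [abs_div, abs_of_pos (by norm_num : (0:ℝ) < 2)]
      _ ≤ (|(a : ℝ)| + |r|) / 2 := by gcongr; exact abs_add_le _ _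
      _ = |(a : ℝ)| / 2 + r / 2 := by rw [abs_of_nonneg hr0]; ring
  have hminus : (((a : ℝ) - r) / 2) ^ 2 ≤ 4 * p := by
    apply hbound
    calc |((a : ℝ) - r) / 2| = |(a : ℝ) - r| / 2 := by rw [abs_div, abs_of_pos (by norm_num : (0:ℝ) < 2)]
      _ ≤ (|(a : ℝ)| + |-r|) / 2 := by rw [sub_eq_add_neg]; gcongr; exact abs_add_le _ _
      _ = |(a : ℝ)| / 2 + r / 2 := by rw [abs_neg, abs_of_nonneg hr0]; ring
  -- conclude with the quadratic `p z² − y z + 1 = 0`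
  rcases hroots with h | h
  · exact norm_sq_eq_inv_of_quadratic hpR hplus (by rw [← h]; exact hq)
  · exact norm_sq_eq_inv_of_quadratic hpR hminus (by rw [← h]; exact hq)

/-- **Type (G) from four integer inequalities**, in the exact shape of the hypothesis `hG` of
`BrumerEtAl2019.existsIntegralSymplecticGaloisRep_two_primeLevel` / `paramodular_of_galoisCertificate_cited`:
for `p > 0` and `a² − 4b + 8p ≥ 0`, `a² ≤ 16p`, `2p + b ≥ 0`, `4a²p ≤ (2p + b)²`, every complex root of
`lPolynomialOfSurface p a b = 1 − aT + bT² − paT³ + p²T⁴` has absolute value `(√p)⁻¹ = p^{−1/2}`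
([BPPTVY, Prop 4.3.2 p. 1168]: "`f` is of type (G)" at `p`; the four inequalities are decided by
`decide`/`norm_num` on certificate data).  The criterion itself is [MN02, Lemma 2.1 (iii) ⇒ (i) p. 323] for
`t⁴·Q(1/t)`. [cite: BrumerEtAl2019, Prop 4.3.2 p. 1168] [cite: MaisnerNart2002, Lemma 2.1 p. 323] -/
theorem typeG_of_ineq {p : ℕ} (hp : 0 < p) {a b : ℤ}
    (h₁ : 0 ≤ a ^ 2 - 4 * b + 8 * p) (h₂ : a ^ 2 ≤ 16 * p) (h₃ : 0 ≤ 2 * p + b)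
    (h₄ : 4 * a ^ 2 * p ≤ (2 * p + b) ^ 2) (z : ℂ)
    (hz : ((lPolynomialOfSurface p a b).map (Int.castRingHom ℂ)).IsRoot z) :
    ‖z‖ = (Real.sqrt p)⁻¹ := by
  have hz' : 1 - (a : ℂ) * z + (b : ℂ) * z ^ 2 - (p : ℂ) * (a : ℂ) * z ^ 3 + (p : ℂ) ^ 2 * z ^ 4 = 0 := by
    have h := hz
    simp only [IsRoot.def, eval_map, lPolynomialOfSurface, eval₂_add, eval₂_sub, eval₂_one, eval₂_mul,
      eval₂_C, eval₂_X, eval₂_X_pow] at h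
    simp only [eq_intCast, Int.cast_mul, Int.cast_pow, Int.cast_natCast] at h
    linear_combination h
  have hsq := norm_sq_eq_inv_of_surface_root hp h₁ h₂ h₃ h₄ hz'
  rw [← Real.sqrt_sq (norm_nonneg z), hsq, Real.sqrt_inv]

/-- The `∃ p₀` form of `hG`: one good prime `p₀ ∤ N` at which the four inequalities hold gives the
type-(G) hypothesis of the cited fact verbatim. [cite: BrumerEtAl2019, Prop 4.3.2 p. 1168; Thm 4.3.4 p. 1169] [cite: MaisnerNart2002, Lemma 2.1 p. 323] -/
theorem exists_typeG_of_ineq {N p₀ : ℕ} (hp₀ : p₀.Prime) (hp₀N : ¬ p₀ ∣ N) (a b : ℕ → ℤ)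
    (h₁ : 0 ≤ a p₀ ^ 2 - 4 * b p₀ + 8 * p₀) (h₂ : a p₀ ^ 2 ≤ 16 * p₀) (h₃ : 0 ≤ 2 * p₀ + b p₀)
    (h₄ : 4 * a p₀ ^ 2 * p₀ ≤ (2 * p₀ + b p₀) ^ 2) :
    ∃ p : ℕ, p.Prime ∧ ¬ p ∣ N ∧ ∀ z : ℂ,
      ((lPolynomialOfSurface p (a p) (b p)).map (Int.castRingHom ℂ)).IsRoot z →
        ‖z‖ = (Real.sqrt p)⁻¹ :=
  ⟨p₀, hp₀, hp₀N, typeG_of_ineq hp₀.pos h₁ h₂ h₃ h₄⟩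

/-- Non-vacuity: for `p = 3`, `(a, b) = (0, 1)` (the shape `L₃ = 1 + T² + 9T⁴`) the four inequalities
hold, so `typeG_of_ineq` applies. [cite: MaisnerNart2002, Lemma 2.1 p. 323] -/
example : (0 : ℤ) ≤ 0 ^ 2 - 4 * 1 + 8 * 3 ∧ (0 : ℤ) ^ 2 ≤ 16 * 3 ∧ (0 : ℤ) ≤ 2 * 3 + 1 ∧
    4 * (0 : ℤ) ^ 2 * 3 ≤ (2 * 3 + 1) ^ 2 := by norm_num

end Literature.NumberTheory.FaltingsSerre
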